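import Summits.Schanuel.Schanuel.Theses.RoyCriterion
import Summits.Schanuel.Schanuel.Theses.EclCore
import Literature.Barriers.Schanuel.LargeTranscendenceDegreeSmallTrdegProofs
import Literature.Barriers.Schanuel.NesterenkoModularScope
import Literature.Barriers.Schanuel.AlgebraicIndependenceOfLogarithms

/-!
# Line `Sketch` (idea `hl-collapse-line-purity`) for crux stmt-Schanuel-0069 `SchanuelTwo` — the lead's skeleton

Crux: `Summit.Schanuel.Schanuel.Theses.RoyCriterion.SchanuelTwo`
(`∀ x : Fin 2 → ℂ, LinearIndependent ℚ x → 2 ≤ trdeg_ℚ ℚ(x, e^x)`, Schanuel's conjecture for `n = 2`).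

The line (crux-ideate r1 ideator 3, `Sketch.lean`, statements only; its evidence blob is not mounted in
the lead's jail, so the skeleton is RECONSTRUCTED here from the published declaration list `DepthOne,
LinePurity, schanuelTwo_iff_depthOne_pairs, schanuelTwo_of_linePurity, …` and the triage files
`Cruxes/SchanuelTwo/TriageR1K1LinePurity.lean`, `…/TriageR1K3.lean`):

* **Hermite–Lindemann collapse.** For `x` `ℚ`-linearly independent, `x i ≠ 0`, so by Hermite–Lindemann
  (tree theorem `transcendental_exp_holds`) `trdeg ℚ(x i, e^{x i}) ≥ 1`; if some coordinate is NOT a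
  depth-one seed (`trdeg ℚ(x i, e^{x i}) ≠ 1`, i.e. `x i, e^{x i}` algebraically independent) the crux
  holds at `x` by monotonicity. So the crux reduces to pairs of DEPTH-ONE SEEDS.
* **Line purity** (`LinePurity`): two `ℚ`-linearly independent depth-one seeds never lie on one "line"
  (a field of transcendence degree `1`): `2 ≤ trdeg ℚ(x, e^x)`.
* Composition: `schanuelTwo_of_linePurity : LinePurity → SchanuelTwo`; the crux by name:
  `SchanuelTwo_of : SchanuelTwo`.

Stubs (sorry only in `stub_*`; v2 = RESHAPED along the card's sector atlas by seed type, so that the part the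
line's `Leans on:` supply is a registered stub of its own and the residual is isolated):
* `stub_purityAlgebraic` — purity for two ALGEBRAIC seeds (the `(E,E)` sector): Lindemann–Weierstrass
  (tree theorem `algebraicIndependent_exp_holds`); CLOSED — landed p87563 as
  `Summit.Schanuel.Schanuel.Theorems.stub_purityAlgebraic` (Theorems/RoyCriterionSchanuelTwoStubPurityAlgebraic.lean);
  the same proof is inlined here (no sorry left in it).
* `stub_purityTranscendental` — purity for two depth-one seeds ONE OF WHICH IS TRANSCENDENTAL (the
  `(E,L) (E,M) (L,L) (L,M) (M,M)` sectors): the load-bearing stub, held by the lead.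
(v1 had the single stub `stub_linePurity : LinePurity`; `LinePurity` is now DERIVED from the two stubs,
`linePurity_of_stubs`.)

COSTUME CERTIFICATE (sorry-free §4, does not use the stubs): `linePurity_iff_schanuelTwo : LinePurity ↔
SchanuelTwo` (two one-liners; triage r1: 3/3 "costume"), `purityTranscendental_iff_schanuelTwo` (the
RESIDUAL stub is still equivalent to the crux, given Hermite–Lindemann + Lindemann–Weierstrass), and
`expOnePi_of_purityTranscendental` — the residual stub implies the algebraic independence of `e` and `π`
(registered OPEN statement `Literature.NumberTheory.Transcendental.ExpOnePiAlgebraicIndependent`, Lang 1966 /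
Waldschmidt 2000 §1.4; `x = (1, πi)` is a pair of depth-one seeds with `πi` transcendental).
-/

set_option linter.dupNamespace false

noncomputable section

open Complex IntermediateField
open Literature.Barriers.Schanuel (trdeg_mono trdeg_adjoin_singleton_le_one
  trdeg_adjoin_union_eq_of_isAlgebraic algebraicIndependent_of_le_trdeg_adjoin)
open Summit.Schanuel.Schanuel.Theses.RoyCriterion (SchanuelTwo)

namespace Summit.Schanuel.Schanuel.Cruxes.SchanuelTwo.LineSketch

/-! ### §0 Objects -/

/-- The Schanuel field `ℚ(x, e^x)` of a pair, as in the crux. -/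
abbrev SF (x : Fin 2 → ℂ) : IntermediateField ℚ ℂ :=
  adjoin ℚ (Set.range x ∪ Set.range (Complex.exp ∘ x))

/-- The Hermite–Lindemann field `ℚ(a, e^a)` of one point. -/
abbrev SF₁ (a : ℂ) : IntermediateField ℚ ℂ := adjoin ℚ ({a, cexp a} : Set ℂ)

/-- A **depth-one seed**: `a ≠ 0` whose own field `ℚ(a, e^a)` has transcendence degree exactly `1`
(by Hermite–Lindemann it is `≥ 1`; `= 1` iff `a` and `e^a` are algebraically dependent). -/
def DepthOne (a : ℂ) : Prop := a ≠ 0 ∧ Algebra.trdeg ℚ (SF₁ a) = 1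

/-- **Line purity**: two `ℚ`-linearly independent depth-one seeds carry two independent
transcendentals, i.e. they never lie on a common "line" (field of transcendence degree `1`). -/
def LinePurity : Prop :=
  ∀ x : Fin 2 → ℂ, LinearIndependent ℚ x → DepthOne (x 0) → DepthOne (x 1) →
    (2 : Cardinal) ≤ Algebra.trdeg ℚ (SF x)

/-! ### §1 Stubs (the only `sorry`s of this file; signatures spelled out def-free so that landed proofs match them textually) -/

/-- STUB `(E,E)` — CLOSED: purity for two algebraic seeds is Lindemann–Weierstrass; LANDED as the registered
stub `Summit.Schanuel.Schanuel.Theorems.stub_purityAlgebraic` (Theorems/RoyCriterionSchanuelTwoStubPurityAlgebraic.lean,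
p87563, accepted 2026-08-16). -/
theorem stub_purityAlgebraic :
    ∀ x : Fin 2 → ℂ, LinearIndependent ℚ x → (∀ i, IsAlgebraic ℚ (x i)) →
      (2 : Cardinal) ≤ Algebra.trdeg ℚ ↥(IntermediateField.adjoin ℚ (Set.range x ∪ Set.range (Complex.exp ∘ x))) := by
  -- proof term identical to the landed `Summit.Schanuel.Schanuel.Theorems.stub_purityAlgebraic` (p87563);
  -- inlined so that this workfile elaborates before the farm has built that module
  intro x hx halg
  have hind : AlgebraicIndependent ℚ (fun i => Complex.exp (x i)) :=
    Literature.NumberTheory.Transcendental.algebraicIndependent_exp_holds x halg hx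
  let y : Fin 2 → ↥(IntermediateField.adjoin ℚ (Set.range x ∪ Set.range (Complex.exp ∘ x))) :=
    fun i => ⟨Complex.exp (x i), IntermediateField.subset_adjoin ℚ _ (Or.inr ⟨i, rfl⟩)⟩
  have hy : AlgebraicIndependent ℚ y :=
    AlgebraicIndependent.of_comp
      (IntermediateField.adjoin ℚ (Set.range x ∪ Set.range (Complex.exp ∘ x))).val hind
  simpa using hy.cardinalMk_le_trdeg

/-- STUB (load-bearing, held by the lead): purity for two depth-one seeds at least one of which is
transcendental — `trdeg ℚ(x i, e^{x i}) = 1` for both `i`, some `x i ∉ ℚ̄`. -/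
theorem stub_purityTranscendental :
    ∀ x : Fin 2 → ℂ, LinearIndependent ℚ x → (∃ i, Transcendental ℚ (x i)) →
      (∀ i, Algebra.trdeg ℚ ↥(IntermediateField.adjoin ℚ ({x i, Complex.exp (x i)} : Set ℂ)) = 1) →
      (2 : Cardinal) ≤ Algebra.trdeg ℚ ↥(IntermediateField.adjoin ℚ (Set.range x ∪ Set.range (Complex.exp ∘ x))) := by
  sorry

/-! ### §2 Bookkeeping lemmas (sorry-free) -/

/-- `SF₁ (x i) ≤ SF x`. -/
theorem SF₁_le_SF (x : Fin 2 → ℂ) (i : Fin 2) : SF₁ (x i) ≤ SF x := by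
  rw [adjoin_le_iff]
  rintro z (rfl | hz)
  · exact subset_adjoin ℚ _ (Or.inl ⟨i, rfl⟩)
  · rw [Set.mem_singleton_iff.mp hz]
    exact subset_adjoin ℚ _ (Or.inr ⟨i, rfl⟩)

/-- `SF x ≤ L` from membership of the four generators. -/
theorem SF_le {x : Fin 2 → ℂ} {L : IntermediateField ℚ ℂ} (h0 : x 0 ∈ L) (h1 : x 1 ∈ L)
    (e0 : cexp (x 0) ∈ L) (e1 : cexp (x 1) ∈ L) : SF x ≤ L := by
  rw [adjoin_le_iff]
  rintro z (⟨i, rfl⟩ | ⟨i, rfl⟩)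
  · fin_cases i
    · exact h0
    · exact h1
  · fin_cases i
    · exact e0
    · exact e1

/-- **Hermite–Lindemann floor** for one point: `a ≠ 0 ⇒ 1 ≤ trdeg ℚ(a, e^a)` (`a` or `e^a` is
transcendental; tree theorem `transcendental_exp_holds`). -/
theorem one_le_trdeg_SF₁ {a : ℂ} (ha : a ≠ 0) : (1 : Cardinal) ≤ Algebra.trdeg ℚ (SF₁ a) := by
  obtain ⟨t, htK, ht⟩ : ∃ t : ℂ, t ∈ SF₁ a ∧ Transcendental ℚ t := by
    by_cases halg : IsAlgebraic ℚ a
    · exact ⟨cexp a, subset_adjoin _ _ (by simp),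
        Literature.NumberTheory.Transcendental.transcendental_exp_holds halg ha⟩
    · exact ⟨a, subset_adjoin _ _ (by simp), halg⟩
  haveI : Algebra.Transcendental ℚ (SF₁ a) :=
    ⟨⟨⟨t, htK⟩, fun h => ht (IntermediateField.isAlgebraic_iff.mp h)⟩⟩
  exact Cardinal.one_le_iff_pos.mpr (trdeg_pos ℚ _)

/-- In `Cardinal`, `1 ≤ t` and `t ≠ 1` give `2 ≤ t`. -/
theorem two_le_of_one_le_of_ne_one {t : Cardinal} (h1 : 1 ≤ t) (hne : t ≠ 1) : 2 ≤ t := by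
  by_contra hlt
  have ht2 : t < 2 := not_le.mp hlt
  have h2al : (2 : Cardinal) < Cardinal.aleph0 := by
    exact_mod_cast Cardinal.natCast_lt_aleph0 (n := 2)
  obtain ⟨n, rfl⟩ := Cardinal.lt_aleph0.1 (ht2.trans h2al)
  have h1' : 1 ≤ n := by exact_mod_cast h1
  have h2' : n < 2 := by exact_mod_cast ht2
  have h3' : n ≠ 1 := fun hn => hne (by rw [hn]; norm_num)
  omega

/-- **Hermite–Lindemann collapse**: a non-zero point that is NOT a depth-one seed already has
`2 ≤ trdeg ℚ(a, e^a)`. -/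
theorem two_le_trdeg_SF₁_of_not_depthOne {a : ℂ} (ha : a ≠ 0) (h : ¬ DepthOne a) :
    (2 : Cardinal) ≤ Algebra.trdeg ℚ (SF₁ a) :=
  two_le_of_one_le_of_ne_one (one_le_trdeg_SF₁ ha) fun h1 => h ⟨ha, h1⟩

/-! ### §3 Composition: the line closes the crux modulo the stubs -/

/-- `LinePurity` from the two sector stubs (dichotomy: both seeds algebraic, or one transcendental). -/
theorem linePurity_of_stubs : LinePurity := by
  intro x hx h0 h1
  by_cases halg : ∀ i, IsAlgebraic ℚ (x i)
  · exact stub_purityAlgebraic x hx halg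
  · push Not at halg
    obtain ⟨i, hi⟩ := halg
    refine stub_purityTranscendental x hx ⟨i, hi⟩ fun j => ?_
    fin_cases j
    · exact h0.2
    · exact h1.2

/-- **Transfer** (`schanuelTwo_of_linePurity` of the Sketch): line purity implies the crux. If a
coordinate `x i` is not a depth-one seed, `ℚ(x i, e^{x i}) ⊆ ℚ(x, e^x)` already has transcendence
degree `≥ 2` (Hermite–Lindemann collapse); otherwise apply purity. -/
theorem schanuelTwo_of_linePurity (hP : LinePurity) : SchanuelTwo := by
  intro x hx
  by_cases h0 : DepthOne (x 0)
  · by_cases h1 : DepthOne (x 1)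
    · exact hP x hx h0 h1
    · exact (two_le_trdeg_SF₁_of_not_depthOne (hx.ne_zero 1) h1).trans (trdeg_mono (SF₁_le_SF x 1))
  · exact (two_le_trdeg_SF₁_of_not_depthOne (hx.ne_zero 0) h0).trans (trdeg_mono (SF₁_le_SF x 0))

/-- **The crux by name, modulo the stub** (route RoyCriterion's decl, payload.route_id). -/
theorem SchanuelTwo_of : SchanuelTwo :=
  schanuelTwo_of_linePurity linePurity_of_stubs

/-- **The crux by name, modulo the stub** — the shared item's other route decl
`Summit.Schanuel.Schanuel.Theses.EclCore.SchanuelTwo` (same signature; the skeleton checker keys on it). -/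
theorem SchanuelTwo_proof : Summit.Schanuel.Schanuel.Theses.EclCore.SchanuelTwo := by
  unfold Summit.Schanuel.Schanuel.Theses.EclCore.SchanuelTwo
  exact SchanuelTwo_of

/-! ### §4 Costume certificate (sorry-free; does not use the stub) -/

/-- The converse transfer is a one-liner: the crux implies line purity. -/
theorem linePurity_of_schanuelTwo (hS : SchanuelTwo) : LinePurity :=
  fun x hx _ _ => hS x hx

/-- **The stub IS the crux**: `LinePurity ↔ SchanuelTwo`. -/
theorem linePurity_iff_schanuelTwo : LinePurity ↔ SchanuelTwo :=
  ⟨schanuelTwo_of_linePurity, linePurity_of_schanuelTwo⟩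

/-- `2 ≤ trdeg ℚ(1, πi, e, e^{πi})` gives the algebraic independence of `e` and `π` (registered OPEN
statement `Literature.NumberTheory.Transcendental.ExpOnePiAlgebraicIndependent`):
`ℚ(1, πi, e, −1) ⊆ ℚ(e, π, i)` and `i` is algebraic. -/
theorem expOnePi_of_two_le_trdeg_SF_one_piI
    (h2 : (2 : Cardinal) ≤ Algebra.trdeg ℚ (SF ![(1 : ℂ), (Real.pi : ℂ) * I])) :
    Literature.NumberTheory.Transcendental.ExpOnePiAlgebraicIndependent := by
  set l : Fin 2 → ℂ := fun i => ((![Real.exp 1, Real.pi] i : ℝ) : ℂ) with hldef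
  have he : ((Real.exp 1 : ℝ) : ℂ) ∈ adjoin ℚ (Set.range l ∪ {I}) :=
    subset_adjoin ℚ _ (Or.inl ⟨0, by simp [hldef]⟩)
  have hpi : (Real.pi : ℂ) ∈ adjoin ℚ (Set.range l ∪ {I}) :=
    subset_adjoin ℚ _ (Or.inl ⟨1, by simp [hldef]⟩)
  have hI : I ∈ adjoin ℚ (Set.range l ∪ {I}) := subset_adjoin ℚ _ (Or.inr rfl)
  have hle : SF ![(1 : ℂ), (Real.pi : ℂ) * I] ≤ adjoin ℚ (Set.range l ∪ {I}) := by
    refine SF_le ?_ ?_ ?_ ?_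
    · simp only [Matrix.cons_val_zero]; exact one_mem _
    · simp only [Matrix.cons_val_one, Matrix.cons_val_fin_one]; exact mul_mem hpi hI
    · simp only [Matrix.cons_val_zero]
      rw [show cexp 1 = ((Real.exp 1 : ℝ) : ℂ) by rw [Complex.ofReal_exp]; simp]
      exact he
    · simp only [Matrix.cons_val_one, Matrix.cons_val_fin_one, Complex.exp_pi_mul_I]
      exact neg_mem (one_mem _)
  have h2' : ((2 : ℕ) : Cardinal) ≤ Algebra.trdeg ℚ (adjoin ℚ (Set.range l)) := by
    have h := (h2.trans (trdeg_mono hle)).trans_eq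
      (trdeg_adjoin_union_eq_of_isAlgebraic (Set.range l) {I}
        (fun x hx => by
          rw [Set.mem_singleton_iff.mp hx]
          exact Literature.Barriers.Schanuel.isAlgebraic_I))
    exact_mod_cast h
  have hC : AlgebraicIndependent ℚ l := algebraicIndependent_of_le_trdeg_adjoin l h2'
  exact Literature.Barriers.Schanuel.algebraicIndependent_real_of_complex _ hC

/-- **The stub implies the algebraic independence of `e` and `π`** (apply purity to `x = (1, πi)`). -/
theorem expOnePi_of_linePurity (hP : LinePurity) :
    Literature.NumberTheory.Transcendental.ExpOnePiAlgebraicIndependent :=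
  expOnePi_of_two_le_trdeg_SF_one_piI
    (schanuelTwo_of_linePurity hP _ Literature.Barriers.Schanuel.linearIndependent_one_piI)

/-! ### §5 What the line's `Leans on:` DO supply: the Lindemann–Weierstrass sector (proof of `stub_purityAlgebraic`) -/

/-- **Purity for two ALGEBRAIC seeds** (the `(E,E)` sector of the atlas) is Lindemann–Weierstrass
(tree theorem `algebraicIndependent_exp_holds`): `e^{x 0}, e^{x 1}` are algebraically independent. This is
the sorry-free proof of `stub_purityAlgebraic` (landed separately under `Theorems/` as the registered stub). -/
theorem purityAlgebraic (x : Fin 2 → ℂ) (hx : LinearIndependent ℚ x)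
    (halg : ∀ i, IsAlgebraic ℚ (x i)) : (2 : Cardinal) ≤ Algebra.trdeg ℚ (SF x) := by
  have hind : AlgebraicIndependent ℚ (fun i => cexp (x i)) :=
    Literature.NumberTheory.Transcendental.algebraicIndependent_exp_holds x halg hx
  let y : Fin 2 → SF x := fun i => ⟨cexp (x i), subset_adjoin ℚ _ (Or.inr ⟨i, rfl⟩)⟩
  have hy : AlgebraicIndependent ℚ y := AlgebraicIndependent.of_comp (SF x).val hind
  simpa using hy.cardinalMk_le_trdeg

/-! ### §6 The residual stub is still the crux (sorry-free; uses `purityAlgebraic`, not the stubs) -/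

/-- The statement of `stub_purityTranscendental`, as a `Prop` (for the certificate only). -/
def PurityTranscendental : Prop :=
  ∀ x : Fin 2 → ℂ, LinearIndependent ℚ x → (∃ i, Transcendental ℚ (x i)) →
    (∀ i, Algebra.trdeg ℚ ↥(IntermediateField.adjoin ℚ ({x i, Complex.exp (x i)} : Set ℂ)) = 1) →
    (2 : Cardinal) ≤ Algebra.trdeg ℚ ↥(IntermediateField.adjoin ℚ (Set.range x ∪ Set.range (Complex.exp ∘ x)))

/-- **The residual stub is equivalent to the crux**: `←` is restriction; `→` runs the composition with
the `(E,E)` sector discharged by Lindemann–Weierstrass (`purityAlgebraic`) and the non-depth-one cases by the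
Hermite–Lindemann collapse. So after removing everything the line's `Leans on:` supply, what is left to
prove is `SchanuelTwo` itself. -/
theorem purityTranscendental_iff_schanuelTwo : PurityTranscendental ↔ SchanuelTwo := by
  constructor
  · intro hT
    refine schanuelTwo_of_linePurity fun x hx h0 h1 => ?_
    by_cases halg : ∀ i, IsAlgebraic ℚ (x i)
    · exact purityAlgebraic x hx halg
    · push Not at halg
      obtain ⟨i, hi⟩ := halg
      refine hT x hx ⟨i, hi⟩ fun j => ?_
      fin_cases j
      · exact h0.2
      · exact h1.2
  · intro hS x hx _ _
    exact hS x hx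

/-- `trdeg ℚ(a, e^a) ≤ 1` when `a` and `e^a` are algebraically DEPENDENT over `ℚ` — here in the only
form needed: `e^a` algebraic over `ℚ` (then `ℚ(a, e^a) = ℚ(a)(e^a)` is algebraic over `ℚ(a)`). -/
theorem trdeg_SF₁_le_one_of_isAlgebraic_exp {a : ℂ} (h : IsAlgebraic ℚ (cexp a)) :
    Algebra.trdeg ℚ (SF₁ a) ≤ 1 := by
  have hsplit : ({a, cexp a} : Set ℂ) = {a} ∪ {cexp a} := by
    ext z; simp [or_comm]
  have heq : Algebra.trdeg ℚ (SF₁ a) = Algebra.trdeg ℚ (adjoin ℚ ({a} : Set ℂ)) := by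
    change Algebra.trdeg ℚ (adjoin ℚ ({a, cexp a} : Set ℂ)) = _
    rw [hsplit]
    exact trdeg_adjoin_union_eq_of_isAlgebraic {a} {cexp a}
      (fun z hz => by rwa [Set.mem_singleton_iff.mp hz])
  rw [heq]
  exact trdeg_adjoin_singleton_le_one a

/-- `trdeg ℚ(a, e^a) ≤ 1` when `a` itself is algebraic over `ℚ`. -/
theorem trdeg_SF₁_le_one_of_isAlgebraic {a : ℂ} (h : IsAlgebraic ℚ a) :
    Algebra.trdeg ℚ (SF₁ a) ≤ 1 := by
  have hsplit : ({a, cexp a} : Set ℂ) = {cexp a} ∪ {a} := by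
    ext z; simp
  have heq : Algebra.trdeg ℚ (SF₁ a) = Algebra.trdeg ℚ (adjoin ℚ ({cexp a} : Set ℂ)) := by
    change Algebra.trdeg ℚ (adjoin ℚ ({a, cexp a} : Set ℂ)) = _
    rw [hsplit]
    exact trdeg_adjoin_union_eq_of_isAlgebraic {cexp a} {a}
      (fun z hz => by rwa [Set.mem_singleton_iff.mp hz])
  rw [heq]
  exact trdeg_adjoin_singleton_le_one (cexp a)

/-- `1` is a depth-one seed (`ℚ(1, e)`: `e` transcendental, `1` algebraic). -/
theorem depthOne_one : DepthOne 1 :=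
  ⟨one_ne_zero, le_antisymm (trdeg_SF₁_le_one_of_isAlgebraic isAlgebraic_one) (one_le_trdeg_SF₁ one_ne_zero)⟩

/-- `πi` is a depth-one seed (`ℚ(πi, e^{πi} = −1)`: `πi` transcendental, `−1` algebraic). -/
theorem depthOne_piI : DepthOne ((Real.pi : ℂ) * I) := by
  have hne : (Real.pi : ℂ) * I ≠ 0 := mul_ne_zero (by exact_mod_cast Real.pi_ne_zero) Complex.I_ne_zero
  refine ⟨hne, le_antisymm (trdeg_SF₁_le_one_of_isAlgebraic_exp ?_) (one_le_trdeg_SF₁ hne)⟩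
  rw [Complex.exp_pi_mul_I]
  simpa using isAlgebraic_algebraMap (R := ℚ) (A := ℂ) (-1)

/-- `πi` is transcendental over `ℚ` (`π` is, and `i` is algebraic). -/
theorem transcendental_piI : Transcendental ℚ ((Real.pi : ℂ) * I) := by
  intro halg
  have hpi : IsAlgebraic ℚ ((Real.pi : ℂ) * I * (-I)) :=
    halg.mul (Literature.Barriers.Schanuel.isAlgebraic_I.neg)
  have : (Real.pi : ℂ) * I * (-I) = Real.pi := by
    rw [mul_assoc, mul_neg, Complex.I_mul_I, neg_neg, mul_one]
  rw [this] at hpi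
  exact Literature.NumberTheory.Transcendental.transcendental_pi_holds
    ((isAlgebraic_algebraMap_iff (Complex.ofReal_injective)).mp
      (by simpa using hpi))

/-- **The residual stub implies the algebraic independence of `e` and `π`**: `x = (1, πi)` is a
`ℚ`-linearly independent pair of depth-one seeds (`depthOne_one`, `depthOne_piI`) with `πi` transcendental,
so `stub_purityTranscendental` applies to it VERBATIM — the open instance sits inside the stub's own
hypotheses, not merely inside the crux. OPEN (Lang 1966; Waldschmidt 2000 §1.4). -/
theorem expOnePi_of_purityTranscendental (hT : PurityTranscendental) :
    Literature.NumberTheory.Transcendental.ExpOnePiAlgebraicIndependent := by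
  refine expOnePi_of_two_le_trdeg_SF_one_piI
    (hT _ Literature.Barriers.Schanuel.linearIndependent_one_piI ⟨1, ?_⟩ fun i => ?_)
  · simpa using transcendental_piI
  · fin_cases i
    · exact depthOne_one.2
    · exact depthOne_piI.2

end Summit.Schanuel.Schanuel.Cruxes.SchanuelTwo.LineSketch

end
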